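import Literature.NumberTheory.QuadraticForms.LocalNormIndex
import HarnessLib

/-!
# The local Hilbert symbol is bimultiplicative at every place

Topic `NumberTheory/QuadraticForms`; namespace `Literature`; all declarations fully proved. For a
number field `K`, a finite place `v` — dyadic places included — and `x y a ∈ K_vˣ`:
`(x y, a)_v = (x, a)_v (y, a)_v` and `(a, x y)_v = (a, x)_v (a, y)_v` (O'Meara §63B, the
formulas after 63:10: `(α, β)_𝔭 (α, γ)_𝔭 = (α, βγ)_𝔭`). This is the content of the local norm
index `(K_vˣ : N(K_v(√a)ˣ)) = 2` (O'Meara 63:13a), proved at every place in `LocalNormIndex.lean`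
(`index_quadraticNormSubgroup_adicCompletion_eq_two`): `x y` is a norm from `K_v(√a)` iff `x`
and `y` are both norms or both non-norms. The non-dyadic case is `hilbertSymbol_mul_left` of
`QuadraticNormIndexLocal.lean`; the present statements drop its hypothesis `v ∤ 2`.

## References

* O. T. O'Meara, *Introduction to quadratic forms*, Grundlehren 117, Springer (1963), §63B
  (63:10, 63:13a; the Hilbert symbol formulas, PDF p. 171).
-/

noncomputable section

open NumberField IsDedekindDomain

namespace Literature.NumberTheory.QuadraticForms

variable (K : Type) [Field K] [NumberField K] (v : HeightOneSpectrum (𝓞 K))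

/-- **The local Hilbert symbol is multiplicative in the first variable, at every finite place**
(dyadic ones included): `(x y, a)_v = (x, a)_v (y, a)_v` for `x y a ∈ K_vˣ` — from the norm
index `2` at `v` (`index_quadraticNormSubgroup_adicCompletion_eq_two`, O'Meara 63:13a).
[cite: Omeara1963, §63B (formulas after 63:10)] -/
theorem hilbertSymbol_adicCompletion_mul_left {x y a : v.adicCompletion K}
    (hx : x ≠ 0) (hy : y ≠ 0) (ha : a ≠ 0) :
    hilbertSymbol (v.adicCompletion K) (x * y) a =
      hilbertSymbol (v.adicCompletion K) x a * hilbertSymbol (v.adicCompletion K) y a := by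
  haveI : CharZero (v.adicCompletion K) :=
    charZero_of_injective_algebraMap (algebraMap K _).injective
  by_cases hasq : IsSquare a
  · rw [hilbertSymbol_comm, hilbertSymbol_eq_one_of_isSquare hasq ha, hilbertSymbol_comm x,
      hilbertSymbol_eq_one_of_isSquare hasq ha, hilbertSymbol_comm y,
      hilbertSymbol_eq_one_of_isSquare hasq ha, one_mul]
  have hN2 := index_quadraticNormSubgroup_adicCompletion_eq_two K v ha hasq
  have key := Subgroup.mul_mem_iff_of_index_two hN2 (a := Units.mk0 x hx) (b := Units.mk0 y hy)
  have hxy : Units.mk0 x hx * Units.mk0 y hy = Units.mk0 (x * y) (mul_ne_zero hx hy) :=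
    Units.ext rfl
  rw [hxy] at key
  have ex := hilbertSymbol_eq_one_iff_mem_quadraticNormSubgroup ha (Units.mk0 x hx)
  have ey := hilbertSymbol_eq_one_iff_mem_quadraticNormSubgroup ha (Units.mk0 y hy)
  have exy := hilbertSymbol_eq_one_iff_mem_quadraticNormSubgroup ha (Units.mk0 (x * y)
    (mul_ne_zero hx hy))
  rw [Units.val_mk0] at ex ey exy
  have hiff : hilbertSymbol (v.adicCompletion K) (x * y) a = 1 ↔
      (hilbertSymbol (v.adicCompletion K) x a = 1 ↔
        hilbertSymbol (v.adicCompletion K) y a = 1) := by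
    rw [exy, ex, ey]
    exact key
  rcases hilbertSymbol_eq_one_or_eq_neg_one x a with h1 | h1 <;>
    rcases hilbertSymbol_eq_one_or_eq_neg_one y a with h3 | h3
  · rw [h1, h3, hiff.2 (by rw [h1, h3]), one_mul]
  · rw [h1, h3, (hilbertSymbol_ne_one_iff _ _).1 fun h ↦ by
      have := (hiff.1 h).1 h1; rw [h3] at this; exact absurd this (by decide)]
    norm_num
  · rw [h1, h3, (hilbertSymbol_ne_one_iff _ _).1 fun h ↦ by
      have := (hiff.1 h).2 h3; rw [h1] at this; exact absurd this (by decide)]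
    norm_num
  · rw [h1, h3, hiff.2 (by rw [h1, h3]), neg_mul, one_mul, neg_neg]

/-- **The local Hilbert symbol is multiplicative in the second variable, at every finite place**:
`(a, x y)_v = (a, x)_v (a, y)_v` for `x y a ∈ K_vˣ` (by symmetry of the symbol).
[cite: Omeara1963, §63B (formulas after 63:10)] -/
theorem hilbertSymbol_adicCompletion_mul_right {x y a : v.adicCompletion K}
    (hx : x ≠ 0) (hy : y ≠ 0) (ha : a ≠ 0) :
    hilbertSymbol (v.adicCompletion K) a (x * y) =
      hilbertSymbol (v.adicCompletion K) a x * hilbertSymbol (v.adicCompletion K) a y := by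
  rw [hilbertSymbol_comm, hilbertSymbol_adicCompletion_mul_left K v hx hy ha, hilbertSymbol_comm x,
    hilbertSymbol_comm y]

end Literature.NumberTheory.QuadraticForms
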